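import Summits.NavierStokesRegularity.NavierStokesRegularity.Theorems.TypeIIInviscidRelaxationAxisymSwirlRegularZhangBarrierRiccatiWCalc
import HarnessLib

/-!
# The κ-inflow barriers, `κ ∈ (0,1]`: the similarity profile `F_W = u · v` and its supersolution inequality

Helper toward the crux `AxisymSwirlRegular` (stmt-NavierStokesRegularity-1964, route TypeIIInviscidRelaxation),
registered line `radial_inflow_split`, criterion side (⟨19059⟩); continuation of `…ZhangBarrierRiccatiW(Calc)`.

THIS FILE (the κ-analogue of `…ZhangBarrierProfile`): for `0 < κ ≤ 1`, `M > 0` the profile `F = profW κ M = u·v`,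
`u = 1 − e^{−h}` (`h = (M/κ)ξ^κ`; `u″ + (Mξ^{κ−1} − 1/ξ)u′ = −(2−κ)u′/ξ`), `v = exp(m_W ψ)`,
`ψ = −(A_W/M)e^{−h} + (2/(2−κ)) arsinh(ξ^{2−κ} − 2M)` (`ψ′ = φ_W`); closed-form `F′, F″` on `ξ > 0`
(`hasDerivAt_profW`, `hasDerivAt_dprofW`), smoothness on `(0,∞)`, continuity on `ℝ`, `F(0) = 0`, `F ≥ 0`, `F′ ≥ 0`,
monotonicity on `[0,∞)`, and **`profileW_ineq`**: `F″ + (Mξ^{κ−1} − 1/ξ − ξ/2)F′ + m_W F ≤ 0` on `(0,∞)`, via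
`F″ + pF′ + mF = v·[(u″ + pu′) + 2mφu′ + m u(φ′ + pφ + mφ² + 1)]`, `u″ + pu′ = −u′((2−κ)/ξ + ξ/2)`,
`2mφ ≤ (5/16)((2−κ)/ξ + ξ/2)` and `riccati_le_W`.  Under `w = Λ(T−t)^m F(r/√(T−t))` the barrier inequality
`w_rr − w_r/r + M r^{κ−1}(T−t)^{−κ/2} w_r ≤ w_t` is `profileW_ineq` at `ξ = r/√(T−t)`.

Pure Mathlib real analysis; no NS statement here. [new]
-/

noncomputable section

set_option linter.dupNamespace false

open Set Filter Topology Real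

namespace Summit.NavierStokesRegularity.NavierStokesRegularity.Theorems.ZhangBarrier

/-- Inner layer `u = 1 − e^{−h}`, `h = (M/κ)ξ^κ`. [new] -/
def uK (κ M ξ : ℝ) : ℝ := 1 - exp (-hK κ M ξ)

/-- `u′ = M ξ^{κ−1} e^{−h}`. [new] -/
def duK (κ M ξ : ℝ) : ℝ := M * ξ ^ (κ - 1) * exp (-hK κ M ξ)

/-- `u″ = e^{−h}((κ−1)Mξ^{κ−2} − (Mξ^{κ−1})²)`. [new] -/
def dduK (κ M ξ : ℝ) : ℝ :=
  exp (-hK κ M ξ) * ((κ - 1) * M * ξ ^ (κ - 2) - (M * ξ ^ (κ - 1)) * (M * ξ ^ (κ - 1)))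

/-- `ψ = −(A_W/M) e^{−h} + (2/(2−κ)) arsinh W`, an ELEMENTARY primitive of `φ_W`. [new] -/
def psiW (κ M ξ : ℝ) : ℝ := -(bigAW κ M / M) * exp (-hK κ M ξ) + 2 / (2 - κ) * arsinh (WK κ M ξ)

/-- Outer factor `v = exp(m_W ψ)`. [new] -/
def vW (κ M ξ : ℝ) : ℝ := exp (expoW κ M * psiW κ M ξ)

/-- `v′ = m φ v`. [new] -/
def dvW (κ M ξ : ℝ) : ℝ := expoW κ M * phiW κ M ξ * vW κ M ξ

/-- `v″ = m v (φ′ + m φ²)`. [new] -/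
def ddvW (κ M ξ : ℝ) : ℝ := expoW κ M * vW κ M ξ * (dphiW κ M ξ + expoW κ M * phiW κ M ξ ^ 2)

/-- **The κ-profile** `F_W = u·v`. [new] -/
def profW (κ M ξ : ℝ) : ℝ := uK κ M ξ * vW κ M ξ

/-- `F′ = u′v + uv′`. [new] -/
def dprofW (κ M ξ : ℝ) : ℝ := duK κ M ξ * vW κ M ξ + uK κ M ξ * dvW κ M ξ

/-- `F″ = u″v + 2u′v′ + uv″`. [new] -/
def ddprofW (κ M ξ : ℝ) : ℝ := dduK κ M ξ * vW κ M ξ + 2 * duK κ M ξ * dvW κ M ξ + uK κ M ξ * ddvW κ M ξ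

/-- `v > 0`. -/
theorem vW_pos (κ M ξ : ℝ) : 0 < vW κ M ξ := exp_pos _

/-- `h ≥ 0` on `[0,∞)`. -/
theorem hK_nonneg {κ M ξ : ℝ} (hκ : 0 < κ) (hM : 0 < M) (hξ : 0 ≤ ξ) : 0 ≤ hK κ M ξ := by
  unfold hK; positivity

/-- `u ≥ 0` on `[0,∞)`. -/
theorem uK_nonneg {κ M ξ : ℝ} (hκ : 0 < κ) (hM : 0 < M) (hξ : 0 ≤ ξ) : 0 ≤ uK κ M ξ := by
  unfold uK
  have : exp (-hK κ M ξ) ≤ 1 := by rw [exp_le_one_iff]; linarith [hK_nonneg hκ hM hξ]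
  linarith

/-- `u ≤ 1`. -/
theorem uK_le_one (κ M ξ : ℝ) : uK κ M ξ ≤ 1 := by
  unfold uK; linarith [exp_pos (-hK κ M ξ)]

/-- `u′ ≥ 0` on `(0,∞)`. -/
theorem duK_nonneg {κ M ξ : ℝ} (hM : 0 < M) (hξ : 0 < ξ) : 0 ≤ duK κ M ξ := by
  unfold duK; have := rpow_pos_of_pos hξ (κ - 1); positivity

/-- `F(0) = 0`. -/
theorem profW_zero {κ M : ℝ} (hκ : 0 < κ) : profW κ M 0 = 0 := by
  simp [profW, uK, hK, zero_rpow hκ.ne']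

/-- `F ≥ 0` on `[0,∞)`. -/
theorem profW_nonneg {κ M ξ : ℝ} (hκ : 0 < κ) (hM : 0 < M) (hξ : 0 ≤ ξ) : 0 ≤ profW κ M ξ :=
  mul_nonneg (uK_nonneg hκ hM hξ) (vW_pos κ M ξ).le

/-- `u′ = duK` on `ξ > 0`. -/
theorem hasDerivAt_uK {κ M ξ : ℝ} (hκ : κ ≠ 0) (hξ : 0 < ξ) : HasDerivAt (uK κ M) (duK κ M ξ) ξ := by
  have hh := hasDerivAt_hK (M := M) hκ hξ
  have h : HasDerivAt (fun x => 1 - exp (-hK κ M x)) (0 - exp (-hK κ M ξ) * -(M * ξ ^ (κ - 1))) ξ :=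
    (hasDerivAt_const ξ (1:ℝ)).sub hh.neg.exp
  refine h.congr_deriv ?_
  simp only [duK]; ring

/-- `u″ = dduK` on `ξ > 0`. -/
theorem hasDerivAt_duK {κ M ξ : ℝ} (hκ : κ ≠ 0) (hξ : 0 < ξ) : HasDerivAt (duK κ M) (dduK κ M ξ) ξ := by
  have hh := hasDerivAt_hK (M := M) hκ hξ
  have h1 : HasDerivAt (fun x => M * x ^ (κ - 1)) (M * ((κ - 1) * ξ ^ (κ - 1 - 1))) ξ :=
    (hasDerivAt_rpow_const (Or.inl hξ.ne')).const_mul M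
  have h : HasDerivAt (fun x => M * x ^ (κ - 1) * exp (-hK κ M x))
      (M * ((κ - 1) * ξ ^ (κ - 1 - 1)) * exp (-hK κ M ξ)
        + M * ξ ^ (κ - 1) * (exp (-hK κ M ξ) * -(M * ξ ^ (κ - 1)))) ξ := h1.mul hh.neg.exp
  refine h.congr_deriv ?_
  rw [show κ - 1 - 1 = κ - 2 by ring]
  simp only [dduK]; ring

/-- `ψ′ = φ_W` on `ξ > 0`. -/
theorem hasDerivAt_psiW {κ M ξ : ℝ} (hκ0 : 0 < κ) (hκ1 : κ ≤ 1) (hM : 0 < M) (hξ : 0 < ξ) :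
    HasDerivAt (psiW κ M) (phiW κ M ξ) ξ := by
  have hh := hasDerivAt_hK (M := M) hκ0.ne' hξ
  have h1 := hh.neg.exp.const_mul (-(bigAW κ M / M))
  have h2 := ((hasDerivAt_WK (κ := κ) (M := M) hξ).arsinh).const_mul (2 / (2 - κ))
  have h : HasDerivAt (fun x => -(bigAW κ M / M) * exp (-hK κ M x) + 2 / (2 - κ) * arsinh (WK κ M x))
      (-(bigAW κ M / M) * (exp (-hK κ M ξ) * -(M * ξ ^ (κ - 1)))
        + 2 / (2 - κ) * ((√(1 + WK κ M ξ ^ 2))⁻¹ • ((2 - κ) * ξ ^ (1 - κ)))) ξ := h1.add h2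
  refine h.congr_deriv ?_
  have h2κ : (2 - κ) ≠ 0 := by linarith
  simp only [phiW, smul_eq_mul]
  field_simp

/-- `v′ = dvW` on `ξ > 0`. -/
theorem hasDerivAt_vW {κ M ξ : ℝ} (hκ0 : 0 < κ) (hκ1 : κ ≤ 1) (hM : 0 < M) (hξ : 0 < ξ) :
    HasDerivAt (vW κ M) (dvW κ M ξ) ξ := by
  have h : HasDerivAt (fun x => exp (expoW κ M * psiW κ M x))
      (exp (expoW κ M * psiW κ M ξ) * (expoW κ M * phiW κ M ξ)) ξ :=
    ((hasDerivAt_psiW hκ0 hκ1 hM hξ).const_mul (expoW κ M)).exp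
  refine h.congr_deriv ?_
  simp only [dvW, vW]; ring

/-- `(v′)′ = ddvW` on `ξ > 0`. -/
theorem hasDerivAt_dvW {κ M ξ : ℝ} (hκ0 : 0 < κ) (hκ1 : κ ≤ 1) (hM : 0 < M) (hξ : 0 < ξ) :
    HasDerivAt (dvW κ M) (ddvW κ M ξ) ξ := by
  have h : HasDerivAt (fun x => expoW κ M * phiW κ M x * vW κ M x)
      (expoW κ M * dphiW κ M ξ * vW κ M ξ + expoW κ M * phiW κ M ξ * dvW κ M ξ) ξ :=
    ((hasDerivAt_phiW hκ0.ne' hξ).const_mul (expoW κ M)).mul (hasDerivAt_vW hκ0 hκ1 hM hξ)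
  refine h.congr_deriv ?_
  simp only [ddvW, dvW]; ring

/-- `F′ = dprofW` on `ξ > 0`. -/
theorem hasDerivAt_profW {κ M ξ : ℝ} (hκ0 : 0 < κ) (hκ1 : κ ≤ 1) (hM : 0 < M) (hξ : 0 < ξ) :
    HasDerivAt (profW κ M) (dprofW κ M ξ) ξ := by
  have h : HasDerivAt (fun x => uK κ M x * vW κ M x) (duK κ M ξ * vW κ M ξ + uK κ M ξ * dvW κ M ξ) ξ :=
    (hasDerivAt_uK hκ0.ne' hξ).mul (hasDerivAt_vW hκ0 hκ1 hM hξ)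
  exact h

/-- `(F′)′ = ddprofW` on `ξ > 0`. -/
theorem hasDerivAt_dprofW {κ M ξ : ℝ} (hκ0 : 0 < κ) (hκ1 : κ ≤ 1) (hM : 0 < M) (hξ : 0 < ξ) :
    HasDerivAt (dprofW κ M) (ddprofW κ M ξ) ξ := by
  have h : HasDerivAt (fun x => duK κ M x * vW κ M x + uK κ M x * dvW κ M x)
      (dduK κ M ξ * vW κ M ξ + duK κ M ξ * dvW κ M ξ + (duK κ M ξ * dvW κ M ξ + uK κ M ξ * ddvW κ M ξ)) ξ :=
    ((hasDerivAt_duK hκ0.ne' hξ).mul (hasDerivAt_vW hκ0 hκ1 hM hξ)).add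
      ((hasDerivAt_uK hκ0.ne' hξ).mul (hasDerivAt_dvW hκ0 hκ1 hM hξ))
  refine h.congr_deriv ?_
  simp only [ddprofW]; ring

/-- `F` is smooth on `(0,∞)`. -/
theorem contDiffOn_profW (κ M : ℝ) {n : WithTop ℕ∞} : ContDiffOn ℝ n (profW κ M) (Ioi 0) := by
  have hpow : ∀ p : ℝ, ContDiffOn ℝ n (fun ξ : ℝ => ξ ^ p) (Ioi 0) :=
    fun p x hx => (contDiffAt_rpow_const_of_ne (p := p) (ne_of_gt hx)).contDiffWithinAt
  have hh : ContDiffOn ℝ n (hK κ M) (Ioi 0) := by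
    have := (hpow κ).const_smul (M / κ)
    exact this.congr (fun x _ => by simp [hK, smul_eq_mul])
  have hu : ContDiffOn ℝ n (uK κ M) (Ioi 0) := by
    have := (contDiffOn_const (c := (1:ℝ))).sub (hh.neg.exp)
    exact this.congr (fun x _ => by simp [uK])
  have hW : ContDiffOn ℝ n (WK κ M) (Ioi 0) := by
    have := (hpow (2 - κ)).sub (contDiffOn_const (c := 2 * M))
    exact this.congr (fun x _ => by simp [WK])
  have hψ : ContDiffOn ℝ n (psiW κ M) (Ioi 0) := by
    have h1 := (hh.neg.exp).const_smul (-(bigAW κ M / M))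
    have h2 := (contDiff_arsinh.comp_contDiffOn hW).const_smul (2 / (2 - κ))
    have := h1.add h2
    exact this.congr (fun x _ => by simp [psiW, smul_eq_mul])
  have hv : ContDiffOn ℝ n (vW κ M) (Ioi 0) := by
    have := (hψ.const_smul (expoW κ M)).exp
    exact this.congr (fun x _ => by simp [vW, smul_eq_mul])
  exact (hu.mul hv).congr (fun x _ => by simp [profW])

/-- `F` is continuous on `ℝ` (only the positive powers `ξ^κ`, `ξ^{2−κ}` enter `F`). -/
theorem continuous_profW {κ M : ℝ} (hκ0 : 0 < κ) (hκ1 : κ ≤ 1) : Continuous (profW κ M) := by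
  have h1 : Continuous (hK κ M) := by
    unfold hK; exact continuous_const.mul (continuous_rpow_const hκ0.le)
  have h2 : Continuous (WK κ M) := by
    unfold WK; exact (continuous_rpow_const (by linarith)).sub continuous_const
  have hu : Continuous (uK κ M) := by unfold uK; fun_prop
  have hψ : Continuous (psiW κ M) := by
    unfold psiW
    have : Continuous (fun x => arsinh (WK κ M x)) := contDiff_arsinh.continuous (n := 0) |>.comp h2
    fun_prop
  have hv : Continuous (vW κ M) := by unfold vW; fun_prop
  unfold profW; fun_prop

/-! ## The supersolution inequality -/

/-- `u″ + (Mξ^{κ−1} − 1/ξ − ξ/2)u′ = −u′((2−κ)/ξ + ξ/2)` on `ξ > 0`. -/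
theorem inner_layer_identity {κ M ξ : ℝ} (hξ : 0 < ξ) :
    dduK κ M ξ + (M * ξ ^ (κ - 1) - ξ⁻¹ - ξ / 2) * duK κ M ξ
      = -(duK κ M ξ) * ((2 - κ) / ξ + ξ / 2) := by
  have e : ξ ^ (κ - 2) = ξ ^ (κ - 1) * ξ⁻¹ := by
    rw [show κ - 2 = κ - 1 - 1 by ring, rpow_sub_one hξ.ne', div_eq_mul_inv]
  simp only [dduK, duK, e]
  field_simp
  ring

/-- `2 m_W φ_W ≤ (5/16)((2−κ)/ξ + ξ/2)` on `ξ > 0`. -/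
theorem two_m_phiW_le {κ M ξ : ℝ} (hκ0 : 0 < κ) (hκ1 : κ ≤ 1) (hM : 0 < M) (hξ : 0 < ξ) :
    2 * expoW κ M * phiW κ M ξ ≤ (5 / 16) * ((2 - κ) / ξ + ξ / 2) := by
  have hA := bigAW_pos hκ0 M
  have hm := expoW_pos hκ0 hM
  obtain ⟨hm16A, -, hm16⟩ := mconsts hA hM hm (expoW_mul hκ0 hM)
  have hm64 : 64 * expoW κ M ≤ 1 := by
    have h := expoW_mul hκ0 hM
    have : 2 * 1 ≤ (bigAW κ M + 2) * (1 + 2 * M) := mul_le_mul (by linarith) (by linarith) zero_le_one (by linarith)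
    nlinarith
  set ρ := ξ ^ (1 - κ) with hρ_def
  have hρ : 0 < ρ := rpow_pos_of_pos hξ _
  have hρinv : ξ ^ (κ - 1) = ρ⁻¹ := by
    rw [hρ_def, ← rpow_neg hξ.le, show -(1 - κ) = κ - 1 by ring]
  have hξinv : 1 ≤ ξ⁻¹ + ξ / 2 := by
    rw [inv_eq_one_div, ← sub_nonneg]
    have : 1 / ξ + ξ / 2 - 1 = ((ξ - 1) ^ 2 + 1) / (2 * ξ) := by field_simp; ring
    rw [this]; positivity
  have hdiv : ξ⁻¹ ≤ (2 - κ) / ξ := by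
    rw [inv_eq_one_div]; exact div_le_div_of_nonneg_right (by linarith) hξ.le
  have hbr1 : 1 ≤ (2 - κ) / ξ + ξ / 2 := by linarith
  have hρbr : ρ⁻¹ ≤ (2 - κ) / ξ + ξ / 2 := by
    rcases le_or_gt ξ 1 with h1 | h1
    · have : ξ ≤ ρ := by
        have := rpow_le_rpow_of_exponent_ge hξ h1 (show 1 - κ ≤ 1 by linarith)
        rwa [rpow_one] at this
      have : ρ⁻¹ ≤ ξ⁻¹ := inv_anti₀ hξ this
      linarith [show (0:ℝ) ≤ ξ / 2 by positivity]
    · have : 1 ≤ ρ := one_le_rpow h1.le (by linarith)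
      have : ρ⁻¹ ≤ 1 := inv_le_one_of_one_le₀ this
      linarith
  have hρle : ρ ≤ 1 + ξ := by
    rcases le_or_gt ξ 1 with h1 | h1
    · have := rpow_le_one hξ.le h1 (show 0 ≤ 1 - κ by linarith); linarith
    · have := rpow_le_rpow_of_exponent_le h1.le (show 1 - κ ≤ 1 by linarith)
      rw [rpow_one] at this; linarith
  have hS1 : 1 ≤ √(1 + WK κ M ξ ^ 2) := by
    rw [le_sqrt (by norm_num) (by positivity)]; nlinarith
  -- `φ ≤ A/ρ + 2ρ`
  have hE1 : exp (-hK κ M ξ) ≤ 1 := by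
    rw [exp_le_one_iff]; linarith [hK_nonneg hκ0 hM hξ.le]
  have hφ : phiW κ M ξ ≤ bigAW κ M * ρ⁻¹ + 2 * ρ := by
    unfold phiW
    rw [hρinv, ← hρ_def]
    have t1 : bigAW κ M * ρ⁻¹ * exp (-hK κ M ξ) ≤ bigAW κ M * ρ⁻¹ := by
      have : 0 ≤ bigAW κ M * ρ⁻¹ := by positivity
      nlinarith
    have t2 : 2 * ρ / √(1 + WK κ M ξ ^ 2) ≤ 2 * ρ := by
      rw [div_le_iff₀ (by positivity)]; nlinarith
    linarith
  have hmφ := mul_le_mul_of_nonneg_left hφ (by positivity : (0:ℝ) ≤ 2 * expoW κ M)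
  -- `2m(A/ρ) ≤ (1/8)/ρ ≤ (1/8)·bracket`, `4mρ ≤ (1/16)(1+ξ) ≤ (3/16)·bracket`
  have t1 : 2 * expoW κ M * (bigAW κ M * ρ⁻¹) ≤ (1 / 8) * ((2 - κ) / ξ + ξ / 2) := by
    have : 2 * expoW κ M * (bigAW κ M * ρ⁻¹) = (2 * expoW κ M * bigAW κ M) * ρ⁻¹ := by ring
    rw [this]
    exact mul_le_mul hm16A hρbr (inv_pos.2 hρ).le (by norm_num)
  have t2 : 2 * expoW κ M * (2 * ρ) ≤ (3 / 16) * ((2 - κ) / ξ + ξ / 2) := by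
    have h1 : 2 * expoW κ M * (2 * ρ) ≤ (1 / 16) * (1 + ξ) := by nlinarith
    have h2 : ξ ≤ 2 * ((2 - κ) / ξ + ξ / 2) := by
      have : 0 ≤ (2 - κ) / ξ := div_nonneg (by linarith) hξ.le
      linarith
    linarith
  nlinarith

/-- **The κ-profile is a supersolution:** `F″ + (Mξ^{κ−1} − 1/ξ − ξ/2)F′ + m_W F ≤ 0` on `(0,∞)`. [new] -/
theorem profileW_ineq {κ M ξ : ℝ} (hκ0 : 0 < κ) (hκ1 : κ ≤ 1) (hM : 0 < M) (hξ : 0 < ξ) :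
    ddprofW κ M ξ + (M * ξ ^ (κ - 1) - ξ⁻¹ - ξ / 2) * dprofW κ M ξ + expoW κ M * profW κ M ξ ≤ 0 := by
  have key : ddprofW κ M ξ + (M * ξ ^ (κ - 1) - ξ⁻¹ - ξ / 2) * dprofW κ M ξ + expoW κ M * profW κ M ξ
      = vW κ M ξ * ((dduK κ M ξ + (M * ξ ^ (κ - 1) - ξ⁻¹ - ξ / 2) * duK κ M ξ)
          + 2 * expoW κ M * phiW κ M ξ * duK κ M ξ
          + expoW κ M * uK κ M ξ
            * (dphiW κ M ξ + (M * ξ ^ (κ - 1) - ξ⁻¹ - ξ / 2) * phiW κ M ξ + expoW κ M * phiW κ M ξ ^ 2 + 1)) := by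
    unfold ddprofW dprofW profW ddvW dvW
    ring
  rw [key, inner_layer_identity hξ]
  have hv := vW_pos κ M ξ
  have hR := riccati_le_W hκ0 hκ1 hM hξ
  have hu := uK_nonneg hκ0 hM hξ.le
  have hu' := duK_nonneg (κ := κ) hM hξ
  have hm := expoW_pos hκ0 hM
  have hφ := two_m_phiW_le hκ0 hκ1 hM hξ
  have hbr : 0 < (2 - κ) / ξ + ξ / 2 := by
    have : 0 < (2 - κ) / ξ := div_pos (by linarith) hξ
    positivity
  have t1 : -(duK κ M ξ) * ((2 - κ) / ξ + ξ / 2) + 2 * expoW κ M * phiW κ M ξ * duK κ M ξ ≤ 0 := by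
    have := mul_le_mul_of_nonneg_left hφ hu'
    nlinarith
  have t2 : expoW κ M * uK κ M ξ
      * (dphiW κ M ξ + (M * ξ ^ (κ - 1) - ξ⁻¹ - ξ / 2) * phiW κ M ξ + expoW κ M * phiW κ M ξ ^ 2 + 1) ≤ 0 :=
    mul_nonpos_of_nonneg_of_nonpos (by positivity) (by linarith)
  exact mul_nonpos_of_nonneg_of_nonpos hv.le (by linarith)

/-- `F′ ≥ 0` on `(0,∞)`. -/
theorem dprofW_nonneg {κ M ξ : ℝ} (hκ0 : 0 < κ) (hM : 0 < M) (hξ : 0 < ξ) : 0 ≤ dprofW κ M ξ := by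
  unfold dprofW dvW
  have := vW_pos κ M ξ
  have := uK_nonneg hκ0 hM hξ.le
  have := duK_nonneg (κ := κ) hM hξ
  have : 0 < phiW κ M ξ := by
    unfold phiW; have := bigAW_pos hκ0 M; have := rpow_pos_of_pos hξ (κ - 1)
    have := rpow_pos_of_pos hξ (1 - κ); positivity
  have := expoW_pos hκ0 hM
  positivity

/-- `F` is nondecreasing on `[0,∞)`. -/
theorem monotoneOn_profW {κ M : ℝ} (hκ0 : 0 < κ) (hκ1 : κ ≤ 1) (hM : 0 < M) :
    MonotoneOn (profW κ M) (Ici 0) := by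
  refine monotoneOn_of_deriv_nonneg (convex_Ici 0) (continuous_profW hκ0 hκ1).continuousOn ?_ ?_
  · rw [interior_Ici]
    exact fun x hx => (hasDerivAt_profW hκ0 hκ1 hM hx).differentiableAt.differentiableWithinAt
  · intro x hx
    rw [interior_Ici] at hx
    rw [(hasDerivAt_profW hκ0 hκ1 hM hx).deriv]
    exact dprofW_nonneg hκ0 hM hx

end Summit.NavierStokesRegularity.NavierStokesRegularity.Theorems.ZhangBarrier

end
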